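import Literature.NumberTheory.Sieve.FGKMT2018Section8Estimates
import HarnessLib

/-!
# FGKMT 2018 §8 — Theorem 6 implies Theorem 5 (local form), hence Theorems 4, 2, 1 and every Rankin constant

Source: K. Ford, B. Green, S. Konyagin, J. Maynard, T. Tao, *Long gaps between primes*, J. Amer.
Math. Soc. 31 (2018) 65–105 = arXiv:1412.5029v4 [FordGreenKonyaginMaynardTao2018], §8 pp. 22–24
(«In this section we deduce Theorem 5 from Theorem 6»).

This file closes the edge «Theorem 6 ⟹ Theorem 5» of the large-gaps DAG:

  `FordGreenKonyaginMaynardTao2018_theorem6ZN → FordGreenKonyaginMaynardTao2018_theorem5_local`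

(`fgkmt2018_theorem5_local_of_theorem6ZN`; `…theorem6ZN` is Theorem 6 ∘ Lemma 7.2 for admissible
NON-DEGENERATE families — the 2026-08-29 erratum on the first rendering `…theorem6Z`, which omitted
non-degeneracy and is no longer used; the §8 families `𝓛_p`, `L̃_{q,i}` and their translates are
non-degenerate, `FGKMT2018Section8Estimates`). Given the data `C, K, F_k, I_k, J_k` of Theorem 6
(`FGKMT2018MultidimensionalSieve`), the constants of Theorem 5 are `r₀ = max C 2`, `u₁ = 1/(40K)`,
`u₂ = max K (1/(40K))`, and for fixed `0 < c ≤ 1`, `K'`, `ε` the constant in (6.3)–(6.5) is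
`kFive K A` with `A` the prime-number-theorem constant of `card_primesHalf_asymp`. For `x` large
(the eventualities of Theorem 6 at `ε`, of `rLevel_window`, `section8_growth`, `tau_growth`, the PNT for
`#𝒫` and `n/φ(n) ≤ 3 log₂ n`) and an admissible `H ⊂ [1, 2r²]` with `r₀ ≤ r = #H ≤ log^{1/5} x`, the
regime structure `Section8Hyp` of `FGKMT2018Section8Estimates` is inhabited with Theorem 6's modulus
`B = B(x)`, and its fields `tau_ge`, `u_mem`, `w_nonneg`, `w_support`, `est63`, `est64`, `est65`, `w_le`
are exactly the assertions (6.2)–(6.6) of `FordGreenKonyaginMaynardTao2018_theorem5_local` for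
`τ = tauVal`, `u = uVal`, `w = wFun` (§8 p. 22: `w(p, n) = w_{r,𝓛_p,B,R}(n)`, `R = (x/4)^{1/9}`).
Composed with `FGKMT2018Theorem5Local` (Theorem 4 from the local Theorem 5, Theorem 3 proved in
`Literature.Combinatorics.Hypergraph`), Theorem 6 (in the form `…theorem6ZN`) alone now yields
Theorems 4, 2, 1 and `RankinConstant κ` for every `κ`.

## References
* K. Ford, B. Green, S. Konyagin, J. Maynard, T. Tao, *Long gaps between primes*, J. Amer. Math.
  Soc. 31 (2018) 65–105, §8 [FordGreenKonyaginMaynardTao2018].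
-/

open Finset Filter Topology

namespace Literature.NumberTheory.Sieve

open FGKMT2018

/-- **Theorem 5 (local form) from Theorem 6** — the deduction of §8 of
[FordGreenKonyaginMaynardTao2018]: with `R = (x/4)^{1/9}`, the modulus `B = B(x)` and the data
`F_k, I_k, J_k, K` of Theorem 6, the weight `w(p, n) = w_{r,𝓛_p,B,R}(n)` (`p ∈ 𝒫`, `|n| ≤ y`),
`τ = 2(B/φB)^r 𝔖 (log R)^r (log x)^r I_r` and `u = (φB/B)(log R/log x) r J_r/(2 I_r)` satisfy
(6.2)–(6.6) with relative errors `≤ kFive K A/log₂^{10} x`; the constants are `r₀ = max C 2`,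
`u₁ = 1/(40K)`, `u₂ = max K (1/(40K))`.
[cite: FordGreenKonyaginMaynardTao2018, §8 pp. 22–24 («Theorem 6 implies Theorem 5»)] -/
theorem fgkmt2018_theorem5_local_of_theorem6ZN (h6 : FordGreenKonyaginMaynardTao2018_theorem6ZN) :
    FordGreenKonyaginMaynardTao2018_theorem5_local := by
  obtain ⟨C, K, F, I, J, hK, hIJ, h6ε⟩ := h6
  refine ⟨max C 2, 1 / (40 * K), max K (1 / (40 * K)), by positivity, le_max_right _ _, ?_⟩
  intro c hc hc1 K' hK' ε hε
  obtain ⟨A, hA, hpnt⟩ := card_primesHalf_asymp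
  refine ⟨kFive K A, by rw [kFive]; positivity, ?_⟩
  obtain ⟨n₀, hn₀⟩ := Filter.eventually_atTop.mp self_div_totient_le_three_mul_loglog
  filter_upwards [h6ε ε hε, rLevel_window,
    section8_growth hc hc1 (3 * A + 2 * K + 1600 * K ^ 2 + K' + 10), tau_growth hK hε, hpnt,
    eventually_ge_atTop (2 * n₀)] with x hx6 hRw hgr hτ hpx hxn₀
  intro H hH hr₀ hr5 hb
  obtain ⟨B, hB, hBx, hblk⟩ := hx6
  obtain ⟨hx32, -, -, -, hlR1, hlRlo, hlRhi, hwin⟩ := hRw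
  obtain ⟨hM, h7, hl11, hl2t, ht10, hL2x, hyle, hley⟩ := hgr
  have hCH : C ≤ #H := le_of_max_le_left hr₀
  obtain ⟨hI0, hIK, hJ1, hJ2⟩ := hIJ (#H) hCH
  have S : Section8Hyp K A (#H) (F #H) (I #H) (J #H) ε c K' x B H :=
    { hK := hK, hA := hA, hK' := hK',
      blk := section8Block_ofN hblk hCH hr5 hwin,
      hB := hB, hBx := hBx, hH := hH, card := rfl, two_le := le_of_max_le_right hr₀, le_t2 := hr5,
      bounds := hb, hI := hI0, hIK := hIK, hJ1 := hJ1, hJ2 := hJ2, hε := hε, hc := hc, hc1 := hc1,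
      M_le := hM, seven_le := h7, l2_pow := hl11, l2_le_t := hl2t, t_pow := ht10, L2_le_x := hL2x,
      y_le := hyle, le_y := hley, x32 := hx32, lR1 := hlR1, lR_lo := hlRlo, lR_hi := hlRhi,
      pnt := hpx,
      tot := fun n hn => hn₀ n (by omega),
      tau_fact := hτ }
  have hℓ : Real.log^[2] (x : ℝ) = Real.log (Real.log x) := by
    rw [Function.iterate_succ_apply', Function.iterate_one]
  refine ⟨tauVal H rfl B x (I #H), S.tau_ge, uVal (#H) B x (I #H) (J #H), S.u_mem.1, S.u_mem.2,
    wFun c x H rfl B (F #H), S.w_nonneg, S.w_support, fun p hp => ?_, fun q hq h hh => ?_,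
    fun h hh hH' => ?_, S.w_le⟩
  · rw [hℓ]; exact S.est63 hp
  · rw [hℓ]; exact S.est64 hq hh
  · rw [hℓ]; exact S.est65 hh hH'

/-- **FGKMT Theorem 4 from Theorem 6.** [cite: FordGreenKonyaginMaynardTao2018, Thm 4 from Thm 5 (§6) and Thm 5 from Thm 6 (§8)] -/
theorem fgkmt2018_theorem4_of_theorem6ZN (h6 : FordGreenKonyaginMaynardTao2018_theorem6ZN) :
    FordGreenKonyaginMaynardTao2018_theorem4 :=
  fgkmt2018_theorem4_of_theorem5_local (fgkmt2018_theorem5_local_of_theorem6ZN h6)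

/-- **FGKMT Theorem 2 from Theorem 6** (Theorem 3 being proved).
[cite: FordGreenKonyaginMaynardTao2018, Thm 2 from Thms 3, 4 (§5); Thm 4 ⇐ Thm 5 ⇐ Thm 6 (§§6–8)] -/
theorem fgkmt2018_theorem2_of_theorem6ZN (h6 : FordGreenKonyaginMaynardTao2018_theorem6ZN) :
    FordGreenKonyaginMaynardTao2018_theorem2 :=
  fgkmt2018_theorem2_of_theorem5_local (fgkmt2018_theorem5_local_of_theorem6ZN h6)

/-- **FGKMT Theorem 1 (`G(X) ≫ log X log₂ X log₄ X / log₃ X`) from Theorem 6.**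
[cite: FordGreenKonyaginMaynardTao2018, Thm 1 from Thm 6 via Thms 2–5 (§§3–8)] -/
theorem fgkmt2018_theorem1_of_theorem6ZN (h6 : FordGreenKonyaginMaynardTao2018_theorem6ZN) :
    FordGreenKonyaginMaynardTao2018_theorem1 :=
  fgkmt2018_theorem1_of_theorem5_local (fgkmt2018_theorem5_local_of_theorem6ZN h6)

/-- **Every Rankin constant from Theorem 6**: `RankinConstant κ` for all real `κ`.
[cite: FordGreenKonyaginMaynardTao2018, Thm 1 ⇒ Rankin's conjecture (§1); Thm 1 ⇐ Thm 6 (§§3–8)] -/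
theorem rankinConstant_of_fgkmt2018_theorem6ZN (h6 : FordGreenKonyaginMaynardTao2018_theorem6ZN)
    (κ : ℝ) : RankinConstant κ :=
  rankinConstant_of_fgkmt2018_theorem5_local (fgkmt2018_theorem5_local_of_theorem6ZN h6) κ

end Literature.NumberTheory.Sieve
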